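import Summits.RiemannHypothesis.RiemannHypothesis.Theorems.JensenPolynomialsFarGumbelDescentDisc
import Summits.RiemannHypothesis.RiemannHypothesis.Theorems.JensenPolynomialsFarGumbelDescentPointwise

/-!
# Route `JensenPolynomials`, FAR crux `XiWindowZeroFreeRelFar` (B1-rel far) — S3 WANTED item (L3): DESCENT along the
line through the saddle disc (RH-FREE; cell rh-jensen, HUMAN RULING D-0040)

Item `stmt-RiemannHypothesis-19465`, stub S3 `stub_laplaceFar` of theory g8's line «far-gumbel», WANTED list v3 (HOME
`eng-4/S3/S3-WANTED.lean`, sha16 `d6f8107cd04d985a`), item (L3) `wanted_descent` — name and signature byte-identical: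
for the far mode `υ` (`4πe^{4υ}υ = 2M + 9υ`, `υ ≥ 189/20`, `M ≥ 2·10¹⁸`), `‖a‖ ≤ (9/25)υ²`, and ANY point `u_s = x_s + iy_s`
of the saddle disc `‖u_s − (υ + ξ₀/4)‖ ≤ 1/(10υ²)`, along the horizontal line `Im u = y_s`:
LEFT  `Re(Ψ(x+iy_s) − Ψ(u_s)) ≤ −Λ/500` for `υ − 2 < x ≤ x_s − 1/30`;
RIGHT `Re(Ψ(x+iy_s) − Ψ(u_s)) ≤ −Λ/500 − (x − x_s − 1/30)` for `x > x_s + 1/30`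
(`Ψ = farPsi M a`, `Λ = farLam υ = πe^{4υ}`).

PROOF (derivative-free). `Re Ψ(u) = log 2π² + 9Re u − Re(πe^{4u}) + log‖u‖ + (M−½)log‖u²+a‖` (`Complex.log_re`), and
`Re(πe^{4(u_s+t)}) = e^{4t}·P` with `P := Re(πe^{4u_s})`; two uses of `log x ≤ x − 1` give the POINTWISE BOUND
`Re Ψ(u_s+t) − Re Ψ(u_s) ≤ −P(e^{4t} − 1 − 4t) + t·β′ + |t|/‖u_s‖ + t²(M−½)/‖q‖ + t²‖2u_s+t‖²(M−½)/(2‖q‖²)`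
(`re_farPsi_shift_sub_le`; `q = u_s²+a`, `β′ = 9 − 4P + Re((2M−1)u_s/q)`). The saddle-disc dictionary
(`descent_dictionary`, file `…FarGumbelDescentDisc`) bounds `P ≥ 0.71Λ`, `|β′| ≤ 25 + 0.045P`, `(M−½)/‖q‖ ≤ P/4`,
`2‖u_s‖²(M−½)/‖q‖² ≤ 0.78P`, so everything reduces to the one-variable facts
`e^{−4s} − 1 + 4s − 0.045s − 1.03s² ≥ 0.0029` on `[1/30, 2.13]` (`descent_left_aux`: `Real.exp_bound` near the window edge,
`(1−s)⁴ ≤ e^{−4s}`, `e^{−4s} ≥ 0` far out) and `e^{4t} − 1 − 4t − 0.045t − t²/4 − 0.78t²(1+t/18)² ≥ 6.97t² − 0.045t`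
(`descent_right_aux`: `Real.sum_le_exp_of_nonneg`), with `Λ ≥ 9·10⁶` absorbing the `O(1)` terms.
(Theory g8's numerics, S 15:04:46Z/15:34:49Z: true edge value `−0.0045Λ` vs `−Λ/500`.)
WHAT THIS IS NOT: an inequality about an explicit elementary function; nothing here bears on the zeros of `ζ` or RH.
Landed `--supports stmt-RiemannHypothesis-19465` by prover-rh-jensen-eng-5-g4-0 (eng-4 g3's dealing 15:31:14Z: (L3) → eng-5).
-/

noncomputable section
-- D-0017: `Summit.RiemannHypothesis.RiemannHypothesis.…` duplicates the namespace BY DESIGN (single-problem summit).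
set_option linter.dupNamespace false

namespace Summit.RiemannHypothesis.RiemannHypothesis.Theorems.JensenPolynomials.FarGumbel

open Complex
open scoped Real

/-! ## (L3) `wanted_descent` -/

/-- (L3) LEFT half: `Re(Ψ(x+iy_s) − Ψ(u_s)) ≤ −Λ/500` for `υ − 2 < x ≤ x_s − 1/30`. -/
theorem wanted_descent_left (M : ℕ) (hM : 2 * 10 ^ 18 ≤ M) (υ : ℝ)
    (hυ : (189 / 20 : ℝ) ≤ υ ∧ 4 * Real.pi * Real.exp (4 * υ) * υ = 2 * (M : ℝ) + 9 * υ)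
    (a : ℂ) (ha : ‖a‖ ≤ (9 / 25 : ℝ) * υ ^ 2) (u_s : ℂ)
    (hu : ‖u_s - ((υ : ℂ) + farXi0 (farW (a / (υ : ℂ) ^ 2)) (1 / υ) / 4)‖ ≤ 1 / (10 * υ ^ 2)) :
    ∀ x ∈ Set.Ioc (υ - 2) (u_s.re - 1 / 30),
      (farPsi M a (x + u_s.im * I) - farPsi M a (u_s.re + u_s.im * I)).re ≤ -(farLam υ / 500) := by
  obtain ⟨hA1, hA2, hA3, hA4, husυ, hq0⟩ := descent_dictionary M υ hυ a ha u_s hu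
  obtain ⟨hυ0, hmode⟩ := hυ
  have hυpos : 0 < υ := by linarith
  have hΛ9 : 9000000 ≤ farLam υ := farLam_ge_nine_million υ hυ0
  set Λ : ℝ := farLam υ with hΛdef
  set P : ℝ := ((π : ℂ) * Complex.exp (4 * u_s)).re with hPdef
  set q : ℂ := u_s ^ 2 + a with hqdef
  set T : ℝ := (M : ℝ) - 1 / 2 with hTdef
  set β : ℝ := 9 - 4 * P + ((2 * (M : ℂ) - 1) * u_s / q).re with hβdef
  clear_value P Λ β T q
  have hPpos : 0 < P := by linarith
  have hT0 : 0 ≤ T := by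
    have h1 : (2 * 10 ^ 18 : ℝ) ≤ (M : ℝ) := by exact_mod_cast hM
    rw [hTdef]
    linarith
  have hβ : |β| ≤ 25 + 9 / 200 * P := hA2
  -- geometry of `u_s`
  have hxs : |u_s.re - υ| ≤ 1 / 8 := by
    have h1 := Complex.abs_re_le_norm (u_s - υ)
    simp only [Complex.sub_re, Complex.ofReal_re] at h1
    exact h1.trans husυ
  have hys : |u_s.im| ≤ 1 / 8 := by
    have h1 := Complex.abs_im_le_norm (u_s - υ)
    simp only [Complex.sub_im, Complex.ofReal_im, sub_zero] at h1
    exact h1.trans husυ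
  obtain ⟨hxs1, hxs2⟩ := abs_le.mp hxs
  have hun : 9 ≤ ‖u_s‖ := by
    calc (9 : ℝ) ≤ u_s.re := by linarith
      _ ≤ |u_s.re| := le_abs_self _
      _ ≤ ‖u_s‖ := Complex.abs_re_le_norm _
  have hu0 : u_s ≠ 0 := by
    intro h
    rw [h, norm_zero] at hun
    linarith
  intro x hx
  obtain ⟨hx1, hx2⟩ := hx
  obtain ⟨hut, hqt⟩ := line_ne_zero hυ0 ha hys hx1
  have hshift : (x : ℂ) + u_s.im * I = u_s + ((x - u_s.re : ℝ) : ℂ) := by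
    apply Complex.ext <;> simp
  rw [hshift] at hut hqt
  rw [hshift, Complex.re_add_im, Complex.sub_re]
  -- the pointwise bound in the dictionary's vocabulary
  have hT0' : 0 ≤ (M : ℝ) - 1 / 2 := by rw [← hTdef]; exact hT0
  have hq0' : u_s ^ 2 + a ≠ 0 := by rw [← hqdef]; exact hq0
  have hB := re_farPsi_shift_sub_le M a u_s (x - u_s.re) hT0' hu0 hq0' hut hqt
  rw [← hPdef, ← hqdef, ← hTdef, ← hβdef] at hB
  set t : ℝ := x - u_s.re with htdef
  clear_value t
  have ht1 : t ≤ -(1 / 30) := by rw [htdef]; linarith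
  have ht2 : -(213 / 100) ≤ t := by rw [htdef]; linarith
  have ht0 : t ≤ 0 := by linarith
  set s : ℝ := -t with hsdef
  clear_value s
  have hs1 : 1 / 30 ≤ s := by rw [hsdef]; linarith
  have hs2 : s ≤ 213 / 100 := by rw [hsdef]; linarith
  have hs0 : 0 ≤ s := by linarith
  have hts : |t| = s := by rw [abs_of_nonpos ht0, hsdef]
  have ht2s : t ^ 2 = s ^ 2 := by rw [hsdef]; ring
  have hexp : Real.exp (4 * t) - 1 - 4 * t = Real.exp (-(4 * s)) - 1 + 4 * s := by
    rw [hsdef]; ring_nf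
  rw [hexp] at hB
  have hC := descent_left_aux hs1 hs2
  -- junk terms
  have j1 : t * β ≤ s * (25 + 9 / 200 * P) := by
    calc t * β ≤ |t * β| := le_abs_self _
      _ = |t| * |β| := abs_mul _ _
      _ ≤ s * (25 + 9 / 200 * P) := by rw [hts]; exact mul_le_mul_of_nonneg_left hβ hs0
  have j2 : |t| / ‖u_s‖ ≤ s / 9 := by
    rw [hts]
    exact div_le_div_of_nonneg_left hs0 (by norm_num) hun
  have j3 : t ^ 2 * (T / ‖q‖) ≤ s ^ 2 * (1 / 4 * P) := by
    rw [ht2s]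
    exact mul_le_mul_of_nonneg_left hA3 (sq_nonneg _)
  have h2u : ‖2 * u_s + (t : ℂ)‖ ^ 2 ≤ 4 * ‖u_s‖ ^ 2 :=
    norm_two_mul_add_sq_le_left ht0 (by linarith only [hxs1, ht2, hυ0])
  have hT2 : 0 ≤ T / (2 * ‖q‖ ^ 2) := div_nonneg hT0 (by positivity)
  have j4 : t ^ 2 * ‖2 * u_s + (t : ℂ)‖ ^ 2 * (T / (2 * ‖q‖ ^ 2)) ≤ s ^ 2 * (39 / 50 * P) := by
    calc t ^ 2 * ‖2 * u_s + (t : ℂ)‖ ^ 2 * (T / (2 * ‖q‖ ^ 2))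
        ≤ t ^ 2 * (4 * ‖u_s‖ ^ 2) * (T / (2 * ‖q‖ ^ 2)) :=
          mul_le_mul_of_nonneg_right (mul_le_mul_of_nonneg_left h2u (sq_nonneg t)) hT2
      _ = s ^ 2 * (2 * ‖u_s‖ ^ 2 * T / ‖q‖ ^ 2) := by rw [ht2s]; ring
      _ ≤ s ^ 2 * (39 / 50 * P) := mul_le_mul_of_nonneg_left hA4 (sq_nonneg _)
  -- combine
  have k1 : P * (29 / 10000) ≤
      P * (Real.exp (-(4 * s)) - 1 + 4 * s - 9 / 200 * s - 103 / 100 * s ^ 2) :=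
    mul_le_mul_of_nonneg_left hC hPpos.le
  linarith [hB, j1, j2, j3, j4, k1, hA1, hΛ9, hs2, hPpos]

/-- (L3) RIGHT half: `Re(Ψ(x+iy_s) − Ψ(u_s)) ≤ −Λ/500 − (x − x_s − 1/30)` for `x > x_s + 1/30`. -/
theorem wanted_descent_right (M : ℕ) (hM : 2 * 10 ^ 18 ≤ M) (υ : ℝ)
    (hυ : (189 / 20 : ℝ) ≤ υ ∧ 4 * Real.pi * Real.exp (4 * υ) * υ = 2 * (M : ℝ) + 9 * υ)
    (a : ℂ) (ha : ‖a‖ ≤ (9 / 25 : ℝ) * υ ^ 2) (u_s : ℂ)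
    (hu : ‖u_s - ((υ : ℂ) + farXi0 (farW (a / (υ : ℂ) ^ 2)) (1 / υ) / 4)‖ ≤ 1 / (10 * υ ^ 2)) :
    ∀ x ∈ Set.Ioi (u_s.re + 1 / 30),
      (farPsi M a (x + u_s.im * I) - farPsi M a (u_s.re + u_s.im * I)).re ≤
        -(farLam υ / 500) - (x - (u_s.re + 1 / 30)) := by
  obtain ⟨hA1, hA2, hA3, hA4, husυ, hq0⟩ := descent_dictionary M υ hυ a ha u_s hu
  obtain ⟨hυ0, hmode⟩ := hυ
  have hυpos : 0 < υ := by linarith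
  have hΛ9 : 9000000 ≤ farLam υ := farLam_ge_nine_million υ hυ0
  set Λ : ℝ := farLam υ with hΛdef
  set P : ℝ := ((π : ℂ) * Complex.exp (4 * u_s)).re with hPdef
  set q : ℂ := u_s ^ 2 + a with hqdef
  set T : ℝ := (M : ℝ) - 1 / 2 with hTdef
  set β : ℝ := 9 - 4 * P + ((2 * (M : ℂ) - 1) * u_s / q).re with hβdef
  clear_value P Λ β T q
  have hΛpos : 0 < Λ := by linarith
  have hPpos : 0 < P := by linarith
  have hT0 : 0 ≤ T := by
    have h1 : (2 * 10 ^ 18 : ℝ) ≤ (M : ℝ) := by exact_mod_cast hM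
    rw [hTdef]
    linarith
  have hβ : |β| ≤ 25 + 9 / 200 * P := hA2
  -- geometry of `u_s`
  have hxs : |u_s.re - υ| ≤ 1 / 8 := by
    have h1 := Complex.abs_re_le_norm (u_s - υ)
    simp only [Complex.sub_re, Complex.ofReal_re] at h1
    exact h1.trans husυ
  have hys : |u_s.im| ≤ 1 / 8 := by
    have h1 := Complex.abs_im_le_norm (u_s - υ)
    simp only [Complex.sub_im, Complex.ofReal_im, sub_zero] at h1
    exact h1.trans husυ
  obtain ⟨hxs1, hxs2⟩ := abs_le.mp hxs
  have hun : 9 ≤ ‖u_s‖ := by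
    calc (9 : ℝ) ≤ u_s.re := by linarith
      _ ≤ |u_s.re| := le_abs_self _
      _ ≤ ‖u_s‖ := Complex.abs_re_le_norm _
  have hu0 : u_s ≠ 0 := by
    intro h
    rw [h, norm_zero] at hun
    linarith
  intro x hx
  have hx1 : u_s.re + 1 / 30 < x := hx
  have hx0 : υ - 2 < x := by linarith
  obtain ⟨hut, hqt⟩ := line_ne_zero hυ0 ha hys hx0
  have hshift : (x : ℂ) + u_s.im * I = u_s + ((x - u_s.re : ℝ) : ℂ) := by
    apply Complex.ext <;> simp
  rw [hshift] at hut hqt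
  rw [hshift, Complex.re_add_im, Complex.sub_re]
  -- the pointwise bound in the dictionary's vocabulary
  have hT0' : 0 ≤ (M : ℝ) - 1 / 2 := by rw [← hTdef]; exact hT0
  have hq0' : u_s ^ 2 + a ≠ 0 := by rw [← hqdef]; exact hq0
  have hB := re_farPsi_shift_sub_le M a u_s (x - u_s.re) hT0' hu0 hq0' hut hqt
  rw [← hPdef, ← hqdef, ← hTdef, ← hβdef] at hB
  set t : ℝ := x - u_s.re with htdef
  clear_value t
  have ht1 : 1 / 30 ≤ t := by rw [htdef]; linarith
  have ht0 : 0 ≤ t := by linarith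
  have hC := descent_right_aux ht0
  have hts : |t| = t := abs_of_nonneg ht0
  -- junk terms
  have j1 : t * β ≤ t * (25 + 9 / 200 * P) := by
    calc t * β ≤ |t * β| := le_abs_self _
      _ = |t| * |β| := abs_mul _ _
      _ ≤ t * (25 + 9 / 200 * P) := by rw [hts]; exact mul_le_mul_of_nonneg_left hβ ht0
  have j2 : |t| / ‖u_s‖ ≤ t / 9 := by
    rw [hts]
    exact div_le_div_of_nonneg_left ht0 (by norm_num) hun
  have j3 : t ^ 2 * (T / ‖q‖) ≤ t ^ 2 * (1 / 4 * P) := mul_le_mul_of_nonneg_left hA3 (sq_nonneg _)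
  have h2u : ‖2 * u_s + (t : ℂ)‖ ^ 2 ≤ 4 * ‖u_s‖ ^ 2 * (1 + t / 18) ^ 2 :=
    norm_two_mul_add_sq_le_right ht0 hun
  have hT2 : 0 ≤ T / (2 * ‖q‖ ^ 2) := div_nonneg hT0 (by positivity)
  have j4 : t ^ 2 * ‖2 * u_s + (t : ℂ)‖ ^ 2 * (T / (2 * ‖q‖ ^ 2)) ≤
      t ^ 2 * (1 + t / 18) ^ 2 * (39 / 50 * P) := by
    calc t ^ 2 * ‖2 * u_s + (t : ℂ)‖ ^ 2 * (T / (2 * ‖q‖ ^ 2))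
        ≤ t ^ 2 * (4 * ‖u_s‖ ^ 2 * (1 + t / 18) ^ 2) * (T / (2 * ‖q‖ ^ 2)) :=
          mul_le_mul_of_nonneg_right (mul_le_mul_of_nonneg_left h2u (sq_nonneg t)) hT2
      _ = t ^ 2 * (1 + t / 18) ^ 2 * (2 * ‖u_s‖ ^ 2 * T / ‖q‖ ^ 2) := by ring
      _ ≤ t ^ 2 * (1 + t / 18) ^ 2 * (39 / 50 * P) :=
          mul_le_mul_of_nonneg_left hA4 (by positivity)
  -- combine
  have k1 : P * (697 / 100 * t ^ 2 - 9 / 200 * t) ≤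
      P * (Real.exp (4 * t) - 1 - 4 * t - 9 / 200 * t - 1 / 4 * t ^ 2
        - 39 / 50 * (t ^ 2 * (1 + t / 18) ^ 2)) :=
    mul_le_mul_of_nonneg_left hC hPpos.le
  have k2 : t * (1 / 30) ≤ t ^ 2 := by nlinarith
  have k3 := mul_le_mul_of_nonneg_left k2 hPpos.le
  have k4 := mul_le_mul_of_nonneg_right hA1 ht0
  have k5 := mul_le_mul_of_nonneg_right hΛ9 ht0
  have k6 := mul_le_mul_of_nonneg_left ht1 hΛpos.le
  linarith [hB, j1, j2, j3, j4, k1, k3, k4, k5, k6, hA1, hΛ9, hPpos, ht1]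

/-- **(L3) of the S3 WANTED list v3: DESCENT ALONG THE LINE** through any point `u_s = x_s + iy_s` of the saddle disc,
window half-width `δ = 1/30`, `A = Λ/500`: LEFT `Re(Ψ(x+iy_s) − Ψ(u_s)) ≤ −Λ/500` for `υ−2 < x ≤ x_s − 1/30`;
RIGHT `≤ −Λ/500 − (x − x_s − 1/30)` for `x > x_s + 1/30`. Name and signature byte-identical to `S3-WANTED.lean` v3
(sha16 `d6f8107cd04d985a`), consumed by eng-4 g3's closer `laplaceFar_of_wanted_v3`. -/
theorem wanted_descent (M : ℕ) (hM : 2 * 10 ^ 18 ≤ M) (υ : ℝ)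
    (hυ : (189 / 20 : ℝ) ≤ υ ∧ 4 * Real.pi * Real.exp (4 * υ) * υ = 2 * (M : ℝ) + 9 * υ)
    (a : ℂ) (ha : ‖a‖ ≤ (9 / 25 : ℝ) * υ ^ 2) (u_s : ℂ)
    (hu : ‖u_s - ((υ : ℂ) + farXi0 (farW (a / (υ : ℂ) ^ 2)) (1 / υ) / 4)‖ ≤ 1 / (10 * υ ^ 2)) :
    (∀ x ∈ Set.Ioc (υ - 2) (u_s.re - 1 / 30),
        (farPsi M a (x + u_s.im * I) - farPsi M a (u_s.re + u_s.im * I)).re ≤ -(farLam υ / 500)) ∧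
    (∀ x ∈ Set.Ioi (u_s.re + 1 / 30),
        (farPsi M a (x + u_s.im * I) - farPsi M a (u_s.re + u_s.im * I)).re ≤
          -(farLam υ / 500) - (x - (u_s.re + 1 / 30))) :=
  ⟨wanted_descent_left M hM υ hυ a ha u_s hu, wanted_descent_right M hM υ hυ a ha u_s hu⟩

end Summit.RiemannHypothesis.RiemannHypothesis.Theorems.JensenPolynomials.FarGumbel

end
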